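import Summits.BirchSwinnertonDyer.BirchSwinnertonDyer.Theorems.TameQuarticSolventSolventPairLowerBoundTwistTprime
import Summits.BirchSwinnertonDyer.BirchSwinnertonDyer.Theorems.TeichmullerTwistDescentStarInvolution
import Summits.BirchSwinnertonDyer.BirchSwinnertonDyer.Theorems.TeichmullerTwistDescentTwistLatticeUnstarred
import Summits.BirchSwinnertonDyer.BirchSwinnertonDyer.Theorems.ManinLocalTwoThreeSameLevelTwistTransport
import Summits.BirchSwinnertonDyer.Rank1Residual.Additive.GordIsogenyInvarianceClasses
import Literature.NumberTheory.DiophantineGeometry.TateAlgorithmTameTypesOddProofs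
import Literature.NumberTheory.EllipticCurves.ManinConstantModularDegree
import HarnessLib

/-!
# Route `TameQuarticManinParity`, crux `TprimeIrrManinUnitOfThreeDvdDegree` (stmt-BirchSwinnertonDyer-24498, LINE 8
# hard half) and its parent `TprimeIrreducibleManinUnit` (23736): the `χ₋₃` TWIST PAIR of the tame quartic class
# (t′) at `3` — the type-`III*` rows follow from the type-`III` partner; Manin `3`-valuations of a pair differ by at
# most one (`--supports`)

Cell `pub/bsd-wall` (D-0145 line seat bsd-line-ttd-p1 g4, on the planner-of-record's sibling Manin route at `3`).
THEOREMS ONLY (no definition, no named fact, no `sorry`). Nothing is closed; BSD is not proved by this; Manin's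
conjecture at `3` is not proved by this.

THE PAIR. On (t′) (`Addv W 3 ∧ SubTprime W 3`: `f₃ = 2`, `e = 4`, Kodaira `III` / `III*`) the quadratic twist by
`3* = −3` stays in (t′) and flips `III ↔ III*` (tree `SolventPairLowerBound.addv_and_subTprime_of_twist_three`,
`kodairaSymbolAt_placeOf_three_of_twist`); Ogg gives `ord₃ Δ_min = 3` on `III`, `= 9` on `III*` (§1). So the integral
`−3`-twist model of a `III` curve is GLOBALLY MINIMAL with `Δ = (−3)⁶ Δ` (ALIGNED; Stevens (5.2) / Pal Prop. 2.5 at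
`q = 3`, tree `TeichmullerTwistDescent.isGloballyMinimal_twistModel_pStar_of_lt_six`), while from a `III*` curve the
minimal model of the twist divides by `u` with `ord₃ u = 1` (§1). All statements are at the prime `3`, F″-free and Kato-free.

* §2 (datum level; the cell's star involution `TeichmullerTwistDescentStarInvolution.padicValInt_c_le_of_twist_datum`,
  every odd `p`, read at `p = 3`): for `W` in (t′) of type `III*` with a LATTICE-OPTIMAL datum `D` at a level `N`,
  `9 ∣ N`, and ANY datum `D'` of a globally minimal model of `W ⊗ χ₋₃` at a level `N' ∣ N`:
  `ord₃ c(D) ≤ ord₃ c(D')` (`padicValInt_c_le_of_IIIstar_of_twist_datum`); for `W` of type `III`: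
  `ord₃ c(D) ≤ ord₃ c(D') + 1` (`padicValInt_c_le_succ_of_III_of_twist_datum`).
* §3 (class level; cell bsd-f2-manin's THEOREM A clause 1 `maninLocalTwoThree_not_dvd_maninConstant_of_untwist_pStar_aligned`
  at `q = 3`): for `W/ℚ` globally minimal, additive at `3`, lattice-optimal `D` at a level `N`, `9 ∣ N`, and `A` ANY
  globally minimal curve with `ord₃ Δ_min(A) = 3` whose `−3`-twist is ISOGENOUS to `W`: `3 ∤ c(D')` for one datum `D'`
  of `A` at a level `N' ∣ N` gives `3 ∤ c(D)` (`not_three_dvd_c_of_twist_of_III`); with ČNS as a hypothesis,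
  `3 ∤ deg(D')` at the conductor level of a (t′) partner suffices (`…_of_not_dvd_degree`).
* §4 the TQMP reading (`tprimeIrr_IIIstar_of_III_partner{,_of_cns}`): on the binders of 24498 / 23736 restricted to
  `ord₃ Δ_min(W) = 9`, `3 ∤ c(D)` follows from ONE good datum (level `∣ N(W)`) on ONE type-`III` curve `A` with
  `A ⊗ χ₋₃ ∼ W`; so LINE 8's hard half lives on type `III` (plus locating a type-`III` member of the twisted class: the
  twist model is one; that prime-to-`3` isogenous members are too is Dokchitser–Dokchitser Thm. 5.1 (1), cite-only,
  NOT used). INSTRUMENT (planner bsd-idea-3 g3, j296773): `deg φ(III*) = 3·deg φ(III)` in 136/136 optimal (t′) pairs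
  with `N ≤ 15000` — ČNS is silent on the `III*` member exactly where §3 transfers it from the `III` member.

References: [Stevens1989] Lemmas (5.2), (5.4); [Pal2012] Prop. 2.5, Lemma 3.1; [EdixhovenManin1991] §4;
[CesnaviciusNeururerSaha2023] Thm. 1.2; [SilvermanATAEC1994] IV.9.4 Steps 4, 9, Table 4.1.
-/

set_option autoImplicit false
-- single-conjunct summit: `Summit.BirchSwinnertonDyer.BirchSwinnertonDyer.…` repeats the name by design
set_option linter.dupNamespace false

noncomputable section

open scoped Classical

open WeierstrassCurve IsDedekindDomain Rat.HeightOneSpectrum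
  Literature.NumberTheory.EllipticCurves Literature.NumberTheory.EllipticCurves.ModularForms
  Literature.NumberTheory.EllipticCurves.Rank1Residual Literature.NumberTheory.DiophantineGeometry
  Summit.BirchSwinnertonDyer.Rank1Residual.Additive
  Summit.BirchSwinnertonDyer.BirchSwinnertonDyer.Theorems

namespace Summit.BirchSwinnertonDyer.BirchSwinnertonDyer.Theorems.TameQuarticManinParity.TwistPairAtThree

/-! ### §0 Arithmetic of `3* = −3` -/

/-- `3* = −3` as a rational. [elementary] -/
theorem pStar_three_rat : ((-1 : ℚ) ^ (3 / 2) * 3 : ℚ) = ((-3 : ℤ) : ℚ) := by norm_num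

/-- `ord₃ (−3) = 1`. [elementary] -/
theorem padicValInt_three_negThree : padicValInt 3 (-3 : ℤ) = 1 := by
  rw [show padicValInt 3 (-3 : ℤ) = padicValInt 3 (3 : ℤ) by simp [padicValInt]]
  exact_mod_cast padicValInt.self (p := 3) (by norm_num)

/-! ### §1 The (t′) twist pair at `3`: the Kodaira / discriminant dictionary, the `−3`-twist, its conductor, its scaling -/

section Cell

variable (W : WeierstrassCurve ℚ) [W.IsElliptic] [W.IsGloballyMinimal]

/-- **(t′) at `3` = Kodaira `III` with `ord₃ Δ_min = 3` or `III*` with `ord₃ Δ_min = 9`** (the b2b dictionary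
`subTprime_three_iff_kodairaSymbolAt_III_or_IIIstar` and Ogg's `ord₃ Δ_min = m + 1` at the tame types,
`ordMinimalDiscriminant_eq_numComponentsAt_add_one_of_kodairaSymbolAt`).
[cite: SilvermanATAEC1994, IV.9.4 Steps 4, 9 and Table 4.1] -/
theorem kodairaSymbolAt_and_padicValInt_of_subTprime (hadd : Addv W 3) (ht : SubTprime W 3) :
    (W.kodairaSymbolAt (placeOf 3) = .III ∧ padicValInt 3 W.minimalDiscriminantInt = 3) ∨
      (W.kodairaSymbolAt (placeOf 3) = .IIIstar ∧ padicValInt 3 W.minimalDiscriminantInt = 9) := by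
  haveI : PerfectField (IsLocalRing.ResidueField ((placeOf 3).adicCompletionIntegers ℚ)) :=
    PerfectField.ofFinite
  have h2 : ringChar (ℤ ⧸ (placeOf 3).asIdeal) ≠ 2 := by rw [ringChar_int_quot_placeOf 3]; decide
  rcases (subTprime_three_iff_kodairaSymbolAt_III_or_IIIstar (W := W) hadd).mp ht with h | h
  · have hord := W.ordMinimalDiscriminant_eq_numComponentsAt_add_one_of_kodairaSymbolAt (placeOf 3) h2
      (Or.inl h)
    rw [ordMinimalDiscriminant_placeOf_eq W 3] at hord
    unfold numComponentsAt at hord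
    rw [h] at hord
    exact Or.inl ⟨h, by simpa [KodairaSymbol.numComponents] using hord⟩
  · have hord := W.ordMinimalDiscriminant_eq_numComponentsAt_add_one_of_kodairaSymbolAt (placeOf 3) h2
      (Or.inr (Or.inl h))
    rw [ordMinimalDiscriminant_placeOf_eq W 3] at hord
    unfold numComponentsAt at hord
    rw [h] at hord
    exact Or.inr ⟨h, by simpa [KodairaSymbol.numComponents] using hord⟩

/-- On (t′) at `3`: `ord₃ Δ_min ∈ {3, 9}`. [cite: SilvermanATAEC1994, IV.9.4 and Table 4.1] -/
theorem padicValInt_eq_three_or_nine_of_subTprime (hadd : Addv W 3) (ht : SubTprime W 3) :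
    padicValInt 3 W.minimalDiscriminantInt = 3 ∨ padicValInt 3 W.minimalDiscriminantInt = 9 :=
  (kodairaSymbolAt_and_padicValInt_of_subTprime W hadd ht).imp (fun h ↦ h.2) fun h ↦ h.2

omit [W.IsGloballyMinimal] in
/-- `9 ∣ N(W)` for `W` additive at `3` (`f₃ ≥ 2`; tree `sq_dvd_conductorNorm_of_not_good_of_not_mult`).
[cite: SilvermanAEC2009, C.16] -/
theorem nine_dvd_conductorNorm_of_addv (hadd : Addv W 3) : 3 ^ 2 ∣ W.conductorNorm ℤ :=
  sq_dvd_conductorNorm_of_not_good_of_not_mult hadd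

variable (V : WeierstrassCurve ℚ) [V.IsElliptic] [V.IsGloballyMinimal] (C : VariableChange ℚ)

/-- **The `−3`-twist of a (t′) curve is a (t′) curve** (any globally minimal model `V` of `W ⊗ χ₋₃`, written with the
cell's `3* = (−1)^{⌊3/2⌋}·3`): `Addv V 3 ∧ SubTprime V 3` (tree `SolventPairLowerBound.addv_and_subTprime_of_twist_three`
at `d = −3`, `ord₃(−3) = 1`). [cite: SilvermanATAEC1994, IV.9.4 and Table 4.1] -/
theorem addv_and_subTprime_of_twist_negThree (hadd : Addv W 3) (ht : SubTprime W 3)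
    (hC : C • W.quadraticTwist ((-1 : ℚ) ^ (3 / 2) * 3) = V) : Addv V 3 ∧ SubTprime V 3 := by
  refine SolventPairLowerBound.addv_and_subTprime_of_twist_three W hadd ht (d := -3) padicValInt_three_negThree V
    ⟨C, ?_⟩
  rw [← hC, pStar_three_rat]

omit [V.IsGloballyMinimal] in
/-- **The Kodaira symbol flips along the pair**: `III ↦ III*`, `III* ↦ III`
(`SolventPairLowerBound.kodairaSymbolAt_placeOf_three_of_twist`). [cite: SilvermanATAEC1994, IV.9.4 and Table 4.1] -/
theorem kodairaSymbolAt_of_twist_negThree (hadd : Addv W 3) (ht : SubTprime W 3)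
    (hC : C • W.quadraticTwist ((-1 : ℚ) ^ (3 / 2) * 3) = V) :
    (W.kodairaSymbolAt (placeOf 3) = .III ∧ V.kodairaSymbolAt (placeOf 3) = .IIIstar) ∨
      (W.kodairaSymbolAt (placeOf 3) = .IIIstar ∧ V.kodairaSymbolAt (placeOf 3) = .III) := by
  refine SolventPairLowerBound.kodairaSymbolAt_placeOf_three_of_twist W hadd ht (d := -3)
    padicValInt_three_negThree V ⟨C, ?_⟩
  rw [← hC, pStar_three_rat]

/-- **`N(W ⊗ χ₋₃) = N(W)` on (t′).** Both curves are (t′), so `f₃ = 2` on both sides (`CondExpTwo`); away from `3`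
the twist by `−3 ≡ 1 (mod 4)` is unramified (`conductorExponent_eq_of_twist_pStar_of_ne`); `N = ∏ p^{f_p}`
(`factorization_conductorNorm_holds`). The cell's `conductorNorm_eq_of_twist_pStar` needs `p ≥ 5` only for
`f_p = 2`, which (t′) supplies at `3`. [cite: SilvermanAEC2009, C.16] [cite: SilvermanATAEC1994, IV.9.4] -/
theorem conductorNorm_eq_of_twist_negThree (hadd : Addv W 3) (ht : SubTprime W 3)
    (hC : C • W.quadraticTwist ((-1 : ℚ) ^ (3 / 2) * 3) = V) : V.conductorNorm ℤ = W.conductorNorm ℤ := by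
  obtain ⟨-, htV⟩ := addv_and_subTprime_of_twist_negThree W V C hadd ht hC
  refine Nat.eq_of_factorization_eq (V.conductorNorm_pos_holds).ne' (W.conductorNorm_pos_holds).ne' fun q ↦ ?_
  by_cases hq : q.Prime
  · haveI : Fact q.Prime := ⟨hq⟩
    have hgen : natGenerator (placeOf q) = q :=
      Literature.NumberTheory.EllipticCurves.Rat.natGenerator_primesEquiv_symm ⟨q, hq⟩
    have hV' := V.factorization_conductorNorm_holds (placeOf q)
    have hW' := W.factorization_conductorNorm_holds (placeOf q)
    rw [hgen] at hV' hW'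
    rw [hV', hW']
    by_cases hq3 : q = 3
    · subst hq3
      have h1 : condExp V 3 = 2 := htV.2.1
      have h2 : condExp W 3 = 2 := ht.2.1
      unfold condExp at h1 h2
      rw [h1, h2]
    · exact conductorExponent_eq_of_twist_pStar_of_ne 3 (by norm_num) W V C hC (placeOf q) (by rw [hgen]; exact hq3)
  · rw [Nat.factorization_eq_zero_of_not_prime _ hq, Nat.factorization_eq_zero_of_not_prime _ hq]

/-- **The scaling along the pair, `III` side**: if `ord₃ Δ_min(W) = 3` then the twisted model is already minimal at
`3`: `ord₃ u(C) = 0` and `ord₃ Δ_min(V) = 9` (`padicValRat_u_eq_zero_and_padicValInt_eq_of_twist_pStar` at `p = 3`).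
[cite: Pal2012, Prop. 2.5] [cite: SilvermanAEC2009, VII.1 Prop. 1.3(b)] -/
theorem padicValRat_u_eq_zero_of_III (h3 : padicValInt 3 W.minimalDiscriminantInt = 3)
    (hC : C • W.quadraticTwist ((-1 : ℚ) ^ (3 / 2) * 3) = V) :
    padicValRat 3 (C.u : ℚ) = 0 ∧ padicValInt 3 V.minimalDiscriminantInt = 9 := by
  obtain ⟨hu, hΔ⟩ :=
    padicValRat_u_eq_zero_and_padicValInt_eq_of_twist_pStar 3 (by norm_num) W V (by omega) C hC
  exact ⟨hu, by omega⟩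

/-- **The scaling along the pair, `III*` side**: if `W` is (t′) with `ord₃ Δ_min(W) = 9` then the minimal model of the
twist divides the twisted model by `u` with `ord₃ u(C) = 1`, and `ord₃ Δ_min(V) = 3`:
`ord₃ Δ_min(V) = 9 + 6 − 12·ord₃ u` (`padicValInt_minimalDiscriminantInt_twist_pStar_eq`) with
`ord₃ Δ_min(V) ∈ {3, 9}` (`V` is (t′)). [cite: Pal2012, Prop. 2.5] [cite: SilvermanAEC2009, VII.1 Prop. 1.3(b)] -/
theorem padicValRat_u_eq_one_of_IIIstar (hadd : Addv W 3) (ht : SubTprime W 3)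
    (h9 : padicValInt 3 W.minimalDiscriminantInt = 9)
    (hC : C • W.quadraticTwist ((-1 : ℚ) ^ (3 / 2) * 3) = V) :
    padicValRat 3 (C.u : ℚ) = 1 ∧ padicValInt 3 V.minimalDiscriminantInt = 3 := by
  obtain ⟨haddV, htV⟩ := addv_and_subTprime_of_twist_negThree W V C hadd ht hC
  have hrel := padicValInt_minimalDiscriminantInt_twist_pStar_eq 3 W V C hC
  rw [h9] at hrel
  rcases padicValInt_eq_three_or_nine_of_subTprime V haddV htV with hV | hV <;> rw [hV] at hrel
  · exact ⟨by omega, hV⟩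
  · omega

end Cell

/-! ### §2 The Manin valuations along the pair differ by at most one (the star involution at `p = 3`, datum level) -/

section Datum

variable (W V : WeierstrassCurve ℚ) [W.IsElliptic] [W.IsGloballyMinimal] [V.IsElliptic] [V.IsGloballyMinimal]
  (C : VariableChange ℚ) {N : ℕ} [NeZero N] {N' : ℕ} [NeZero N']

/-- **`III*` side: `ord₃ c(D) ≤ ord₃ c(D')`.** `W` in (t′) with `ord₃ Δ_min(W) = 9` (type `III*`), `D` a
LATTICE-OPTIMAL datum of `W` at a level `N` with `9 ∣ N`; `C • (W ⊗ χ₋₃) = V` globally minimal (then `ord₃ u(C) = 1`);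
`D'` ANY datum of `V` at a level `N' ∣ N`. Then `ord₃ c(D) ≤ ord₃ c(D')` — the tree's star involution
`TeichmullerTwistDescentStarInvolution.padicValInt_c_le_of_twist_datum` (`ord_p c(D) ≤ 1 − ord_p u + ord_p c(D')`,
every odd `p`) at `p = 3`. [cite: EdixhovenManin1991, §4] [cite: Stevens1989, Lemma (5.4) p. 97] -/
theorem padicValInt_c_le_of_IIIstar_of_twist_datum (hadd : Addv W 3) (ht : SubTprime W 3)
    (h9 : padicValInt 3 W.minimalDiscriminantInt = 9)
    (hC : C • W.quadraticTwist ((-1 : ℚ) ^ (3 / 2) * 3) = V)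
    (D : ModularParametrizationData W N) (hopt : ∀ z ∈ D.L.lattice, ∃ w ∈ periodLattice D.f, z = D.c * w)
    (h9N : 3 ^ 2 ∣ N) (hN : N' ∣ N) (D' : ModularParametrizationData V N') :
    padicValInt 3 D.c ≤ padicValInt 3 D'.c := by
  have hle := TeichmullerTwistDescentStarInvolution.padicValInt_c_le_of_twist_datum 3 (by norm_num) W V hadd C hC
    D hopt h9N hN D'
  rw [(padicValRat_u_eq_one_of_IIIstar W V C hadd ht h9 hC).1] at hle
  push_cast at hle
  omega

/-- **`III*` side, unit form**: in the situation of `padicValInt_c_le_of_IIIstar_of_twist_datum`, `3 ∤ c(D')` for ONE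
datum of the twist gives `3 ∤ c(D)`. [cite: EdixhovenManin1991, §4] [cite: Stevens1989, Lemma (5.4) p. 97] -/
theorem not_three_dvd_c_of_IIIstar_of_twist_datum (hadd : Addv W 3) (ht : SubTprime W 3)
    (h9 : padicValInt 3 W.minimalDiscriminantInt = 9)
    (hC : C • W.quadraticTwist ((-1 : ℚ) ^ (3 / 2) * 3) = V)
    (D : ModularParametrizationData W N) (hopt : ∀ z ∈ D.L.lattice, ∃ w ∈ periodLattice D.f, z = D.c * w)
    (h9N : 3 ^ 2 ∣ N) (hN : N' ∣ N) (D' : ModularParametrizationData V N') (hc' : ¬ (3 : ℤ) ∣ D'.c) :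
    ¬ (3 : ℤ) ∣ D.c :=
  TeichmullerTwistDescentStarInvolution.not_dvd_c_of_twist_datum 3 (by norm_num) W V hadd C hC
    (padicValRat_u_eq_one_of_IIIstar W V C hadd ht h9 hC).1 D hopt h9N hN D' hc'

omit [W.IsGloballyMinimal] in
/-- **`III` side: `ord₃ c(D) ≤ ord₃ c(D') + 1`.** `W` globally minimal, additive at `3` with `ord₃ Δ_min(W) = 3` (on
(t′): type `III`), `D` a LATTICE-OPTIMAL datum of `W` at a level `N` with `9 ∣ N`; `C • (W ⊗ χ₋₃) = V` globally minimal
(then `ord₃ u(C) = 0`); `D'` ANY datum of `V` at a level `N' ∣ N`. Then `ord₃ c(D) ≤ ord₃ c(D') + 1` — "`3` divides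
`c` at most once more than on the starred side". [cite: EdixhovenManin1991, Thm. 3 and §4]
[cite: Stevens1989, Lemma (5.4) p. 97] -/
theorem padicValInt_c_le_succ_of_III_of_twist_datum [W.IsGloballyMinimal] (hadd : Addv W 3)
    (h3 : padicValInt 3 W.minimalDiscriminantInt = 3)
    (hC : C • W.quadraticTwist ((-1 : ℚ) ^ (3 / 2) * 3) = V)
    (D : ModularParametrizationData W N) (hopt : ∀ z ∈ D.L.lattice, ∃ w ∈ periodLattice D.f, z = D.c * w)
    (h9N : 3 ^ 2 ∣ N) (hN : N' ∣ N) (D' : ModularParametrizationData V N') :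
    padicValInt 3 D.c ≤ padicValInt 3 D'.c + 1 := by
  have hle := TeichmullerTwistDescentStarInvolution.padicValInt_c_le_of_twist_datum 3 (by norm_num) W V hadd C hC
    D hopt h9N hN D'
  rw [(padicValRat_u_eq_zero_of_III W V C h3 hC).1] at hle
  push_cast at hle
  omega

omit [W.IsGloballyMinimal] in
/-- **`III` side, unit form**: `3 ∤ c(D')` for one datum of the twist gives `ord₃ c(D) ≤ 1`.
[cite: EdixhovenManin1991, Thm. 3 and §4] -/
theorem padicValInt_c_le_one_of_III_of_twist_datum [W.IsGloballyMinimal] (hadd : Addv W 3)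
    (h3 : padicValInt 3 W.minimalDiscriminantInt = 3)
    (hC : C • W.quadraticTwist ((-1 : ℚ) ^ (3 / 2) * 3) = V)
    (D : ModularParametrizationData W N) (hopt : ∀ z ∈ D.L.lattice, ∃ w ∈ periodLattice D.f, z = D.c * w)
    (h9N : 3 ^ 2 ∣ N) (hN : N' ∣ N) (D' : ModularParametrizationData V N') (hc' : ¬ (3 : ℤ) ∣ D'.c) :
    padicValInt 3 D.c ≤ 1 :=
  TeichmullerTwistDescentStarInvolution.padicValInt_c_le_one_of_twist_datum 3 (by norm_num) W V hadd C hC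
    (padicValRat_u_eq_zero_of_III W V C h3 hC).1 D hopt h9N hN D' hc'

end Datum

/-! ### §3 The class form of the aligned direction: `3 ∤ c` moves from ANY type-`III` partner UP to `W` -/

section Class

/-- **`3 ∤ c` transfers from a type-`III` twist partner to the whole twisted class** (cell bsd-f2-manin's THEOREM A
clause 1, `maninLocalTwoThree_not_dvd_maninConstant_of_untwist_pStar_aligned`, at `q = 3`). Let `W/ℚ` be globally
minimal, additive at `3`, with a LATTICE-OPTIMAL datum `D` at a level `N`, `9 ∣ N`; let `A/ℚ` be globally minimal with
`ord₃ Δ_min(A) = 3` (on (t′): type `III`) and `A ⊗ χ₋₃` ISOGENOUS to `W` (any isogeny, no irreducibility); let `D'`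
be ANY datum of `A` at a level `N' ∣ N`. If `3 ∤ c(D')` then `3 ∤ c(D)`. The alignment `Δ(T) = (−3)⁶ Δ(A)` for the
integral twist model `T = A.twistModel (−1)` — GLOBALLY MINIMAL because `ord₃ Δ_min(A) < 6`
(`TeichmullerTwistDescent.isGloballyMinimal_twistModel_pStar_of_lt_six`, Stevens (5.2) / Pal Prop. 2.5 at `q = 3`) —
is what makes the divisibility `c(D) ∣ c(D')` exact. [cite: Stevens1989, Lemmas (5.2), (5.4)]
[cite: Pal2012, Prop. 2.5 and Lemma 3.1] [cite: EdixhovenManin1991, §4] -/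
theorem not_three_dvd_c_of_twist_of_III
    (W : WeierstrassCurve ℚ) [W.IsElliptic] [W.IsGloballyMinimal] (hW : Addv W 3)
    {N : ℕ} [NeZero N] (D : ModularParametrizationData W N)
    (hopt : ∀ z ∈ D.L.lattice, ∃ w ∈ periodLattice D.f, z = D.c * w) (h9N : 3 ^ 2 ∣ N)
    (A : WeierstrassCurve ℚ) [A.IsElliptic] [A.IsGloballyMinimal]
    (h3 : padicValInt 3 A.minimalDiscriminantInt = 3)
    (hAW : IsIsogenous (A.quadraticTwist ((-1 : ℚ) ^ (3 / 2) * 3)) W)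
    {N' : ℕ} [NeZero N'] (D' : ModularParametrizationData A N') (hN : N' ∣ N)
    (hc' : ¬ (3 : ℤ) ∣ D'.c) : ¬ (3 : ℤ) ∣ D.c := by
  -- the integral twist model `T = A.twistModel k`, `k = (3* − 1)/4 = −1`, is globally minimal (`ord₃ Δ_min(A) < 6`)
  set k : ℤ := ((-1 : ℤ) ^ (3 / 2) * 3 - 1) / 4 with hk
  haveI hTmin : (A.twistModel ((k : ℤ) : ℚ)).IsGloballyMinimal :=
    TeichmullerTwistDescent.isGloballyMinimal_twistModel_pStar_of_lt_six A (q := 3) (by norm_num) (by omega)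
  have hd0 : ((-1 : ℚ) ^ (3 / 2) * 3) ≠ 0 := by norm_num
  have hk1 : (4 * ((k : ℤ) : ℚ) + 1) = (-1 : ℚ) ^ (3 / 2) * 3 := by rw [hk]; norm_num
  haveI hTell : (A.twistModel ((k : ℤ) : ℚ)).IsElliptic :=
    ⟨by rw [twistModel_Δ, hk1]; exact (IsUnit.mk0 _ (pow_ne_zero 6 hd0)).mul A.isUnit_Δ⟩
  -- `C₁ • T = A ⊗ χ₋₃`, so `u := C₁⁻¹` carries the twist to `T`, and `T ∼ W`
  obtain ⟨C₁, -, hC₁⟩ := exists_variableChange_twistModel_eq_quadraticTwist A ((k : ℤ) : ℚ)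
  rw [hk1] at hC₁
  have hTW : IsIsogenous (A.twistModel ((k : ℤ) : ℚ)) W := (isIsogenous_of_smul_eq hC₁).trans' hAW
  -- the cell's `3*` as a cast integer
  have e : ((((-1 : ℤ) ^ (3 / 2) * ((3 : ℕ) : ℤ) : ℤ)) : ℚ) = (-1 : ℚ) ^ (3 / 2) * 3 := by norm_num
  refine maninLocalTwoThree_not_dvd_maninConstant_of_untwist_pStar_aligned (q := 3) (by norm_num) D hopt D' hN
    h9N hW (u := C₁⁻¹) ?_ hTW ?_ hc'
  · -- `u := C₁⁻¹` carries `A ⊗ χ₋₃` to the twist model `T`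
    rw [e, ← hC₁, inv_smul_smul]
  · -- ALIGNED: `Δ(T) = (3*)⁶ Δ(A)`
    rw [e, twistModel_Δ, hk1]

/-- **The same with the twist written as `A ⊗ ℚ(√−3)`** (`(−1)^{⌊3/2⌋}·3 = −3`). [cite: Stevens1989, Lemmas (5.2), (5.4)] -/
theorem not_three_dvd_c_of_twist_negThree_of_III
    (W : WeierstrassCurve ℚ) [W.IsElliptic] [W.IsGloballyMinimal] (hW : Addv W 3)
    {N : ℕ} [NeZero N] (D : ModularParametrizationData W N)
    (hopt : ∀ z ∈ D.L.lattice, ∃ w ∈ periodLattice D.f, z = D.c * w) (h9N : 3 ^ 2 ∣ N)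
    (A : WeierstrassCurve ℚ) [A.IsElliptic] [A.IsGloballyMinimal]
    (h3 : padicValInt 3 A.minimalDiscriminantInt = 3) (hAW : IsIsogenous (A.quadraticTwist (-3 : ℚ)) W)
    {N' : ℕ} [NeZero N'] (D' : ModularParametrizationData A N') (hN : N' ∣ N)
    (hc' : ¬ (3 : ℤ) ∣ D'.c) : ¬ (3 : ℤ) ∣ D.c := by
  refine not_three_dvd_c_of_twist_of_III W hW D hopt h9N A h3 ?_ D' hN hc'
  have h : ((-1 : ℚ) ^ (3 / 2) * 3) = -3 := by norm_num
  rwa [h]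

/-- **With Česnavičius–Neururer–Saha (cite-only, the hypothesis `hCNS`)**: if the type-`III` partner `A` is in (t′)
(`f₃(A) = 2`, so `27 ∤ N(A)`) and carries a CONDUCTOR-LEVEL datum `D'` of modular degree prime to `3`, with
`N(A) ∣ N`, then `3 ∤ c(D')` (ČNS Thm. 1.2, `not_three_dvd_maninConstant_of_not_dvd_modularDegree`) and hence
`3 ∤ c(D)`. Granted modularity `N(A) = N(A ⊗ χ₋₃) = N(W)` (`conductorNorm_eq_of_twist_negThree`; conductor of an isogeny
class), so `N(A) ∣ N(W)` is automatic there; it is kept as a hypothesis to stay modularity-free.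
[cite: CesnaviciusNeururerSaha2023, Thm. 1.2] [cite: Stevens1989, Lemmas (5.2), (5.4)] -/
theorem not_three_dvd_c_of_twist_of_III_of_not_dvd_degree
    (hCNS : cesnaviciusNeururerSaha_padicVal_maninConstant_le_modularDegree)
    (W : WeierstrassCurve ℚ) [W.IsElliptic] [W.IsGloballyMinimal] (hW : Addv W 3)
    {N : ℕ} [NeZero N] (D : ModularParametrizationData W N)
    (hopt : ∀ z ∈ D.L.lattice, ∃ w ∈ periodLattice D.f, z = D.c * w) (h9N : 3 ^ 2 ∣ N)
    (A : WeierstrassCurve ℚ) [A.IsElliptic] [A.IsGloballyMinimal] [NeZero (A.conductorNorm ℤ)]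
    (htA : SubTprime A 3) (h3 : padicValInt 3 A.minimalDiscriminantInt = 3)
    (hAW : IsIsogenous (A.quadraticTwist ((-1 : ℚ) ^ (3 / 2) * 3)) W)
    (D' : ModularParametrizationData A (A.conductorNorm ℤ)) (hN : A.conductorNorm ℤ ∣ N)
    (hdeg : ¬ 3 ∣ D'.modularDegree) : ¬ (3 : ℤ) ∣ D.c := by
  -- `27 ∤ N(A)` on (t′): `N(A).factorization 3 = f₃(A) = 2`
  have h27 : ¬ 3 ^ 3 ∣ A.conductorNorm ℤ := by
    have h2 : condExp A 3 = 2 := htA.2.1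
    have hgen : natGenerator (placeOf 3) = 3 :=
      Literature.NumberTheory.EllipticCurves.Rat.natGenerator_primesEquiv_symm ⟨3, Nat.prime_three⟩
    have hf := A.factorization_conductorNorm_holds (placeOf 3)
    rw [hgen] at hf
    intro hdvd
    have hle : 3 ≤ (A.conductorNorm ℤ).factorization 3 :=
      (Nat.prime_three.pow_dvd_iff_le_factorization (NeZero.ne _)).mp hdvd
    unfold condExp at h2
    rw [hf, h2] at hle
    omega
  exact not_three_dvd_c_of_twist_of_III W hW D hopt h9N A h3 hAW D' hN
    (not_three_dvd_maninConstant_of_not_dvd_modularDegree hCNS A D' (Or.inl h27) hdeg)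

end Class

/-! ### §4 The TQMP reading: the `III*` rows of `TprimeIrrManinUnitOfThreeDvdDegree` (24498) /
`TprimeIrreducibleManinUnit` (23736) follow from ONE good datum on ONE type-`III` partner -/

section TQMP

/-- **LINE 8's hard half on the `III*` stratum, from the `III` partner.** On the binders of
`Theses.TameQuarticManinParity.TprimeIrrManinUnitOfThreeDvdDegree` (stmt-BirchSwinnertonDyer-24498) restricted to
`ord₃ Δ_min(W) = 9` (Kodaira `III*`): `3 ∤ c(D)` as soon as SOME globally minimal `A` with `ord₃ Δ_min(A) = 3` and
`A ⊗ χ₋₃ ∼ W` carries SOME datum `D'` at a level dividing `N(W)` with `3 ∤ c(D')`. The binders `¬ HasCM`, (t′),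
irreducibility, degree-minimality, `3 ∣ deg`, `ord₃ Δ_min(W) = 9` are NOT used (displayed for the item's shape): the
transfer is the aligned twist transport of §3. [cite: Stevens1989, Lemmas (5.2), (5.4)] [cite: EdixhovenManin1991, §4] -/
theorem tprimeIrr_IIIstar_of_III_partner
    (W : WeierstrassCurve ℚ) [W.IsElliptic] [W.IsGloballyMinimal] [NeZero (W.conductorNorm ℤ)]
    (_hcm : ¬ W.HasCM) (hadd : Addv W 3) (_ht : SubTprime W 3) (_hirr : W.HasIrreducibleModPGaloisRep 3)
    (_h9 : padicValInt 3 W.minimalDiscriminantInt = 9)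
    (D : ModularParametrizationData W (W.conductorNorm ℤ))
    (hlat : ∀ z ∈ D.L.lattice, ∃ w ∈ periodLattice D.f, z = D.c * w)
    (_hmin : ∀ (W' : WeierstrassCurve ℚ) [W'.IsElliptic] (D₁ : ModularParametrizationData W' (W.conductorNorm ℤ)),
      D₁.f = D.f → D.modularDegree ≤ D₁.modularDegree)
    (_hdeg : 3 ∣ D.modularDegree)
    (A : WeierstrassCurve ℚ) [A.IsElliptic] [A.IsGloballyMinimal]
    (h3 : padicValInt 3 A.minimalDiscriminantInt = 3) (hAW : IsIsogenous (A.quadraticTwist (-3 : ℚ)) W)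
    {N' : ℕ} [NeZero N'] (D' : ModularParametrizationData A N') (hN : N' ∣ W.conductorNorm ℤ)
    (hc' : ¬ (3 : ℤ) ∣ D'.maninConstant) : ¬ (3 : ℤ) ∣ D.maninConstant :=
  not_three_dvd_c_of_twist_negThree_of_III W hadd D hlat (nine_dvd_conductorNorm_of_addv W hadd) A h3 hAW D' hN hc'

/-- **The same GRANTED ČNS (cite-only hypothesis `hCNS`)**: the `III*` row of 24498 for `W` follows from a type-`III`
(t′) partner `A` (`A ⊗ χ₋₃ ∼ W`, `N(A) ∣ N(W)`) whose CONDUCTOR-LEVEL datum `D'` has `3 ∤ deg(D')` (ČNS on `A`, where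
`27 ∤ N(A)`, then §3). [cite: CesnaviciusNeururerSaha2023, Thm. 1.2] [cite: Stevens1989, Lemmas (5.2), (5.4)] -/
theorem tprimeIrr_IIIstar_of_III_partner_of_cns
    (hCNS : cesnaviciusNeururerSaha_padicVal_maninConstant_le_modularDegree)
    (W : WeierstrassCurve ℚ) [W.IsElliptic] [W.IsGloballyMinimal] [NeZero (W.conductorNorm ℤ)]
    (_hcm : ¬ W.HasCM) (hadd : Addv W 3) (_ht : SubTprime W 3) (_hirr : W.HasIrreducibleModPGaloisRep 3)
    (_h9 : padicValInt 3 W.minimalDiscriminantInt = 9)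
    (D : ModularParametrizationData W (W.conductorNorm ℤ))
    (hlat : ∀ z ∈ D.L.lattice, ∃ w ∈ periodLattice D.f, z = D.c * w)
    (_hmin : ∀ (W' : WeierstrassCurve ℚ) [W'.IsElliptic] (D₁ : ModularParametrizationData W' (W.conductorNorm ℤ)),
      D₁.f = D.f → D.modularDegree ≤ D₁.modularDegree)
    (_hdeg : 3 ∣ D.modularDegree)
    (A : WeierstrassCurve ℚ) [A.IsElliptic] [A.IsGloballyMinimal] [NeZero (A.conductorNorm ℤ)]
    (htA : SubTprime A 3) (h3 : padicValInt 3 A.minimalDiscriminantInt = 3)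
    (hAW : IsIsogenous (A.quadraticTwist (-3 : ℚ)) W)
    (D' : ModularParametrizationData A (A.conductorNorm ℤ)) (hN : A.conductorNorm ℤ ∣ W.conductorNorm ℤ)
    (hdeg' : ¬ 3 ∣ D'.modularDegree) : ¬ (3 : ℤ) ∣ D.maninConstant := by
  refine not_three_dvd_c_of_twist_of_III_of_not_dvd_degree hCNS W hadd D hlat (nine_dvd_conductorNorm_of_addv W hadd)
    A htA h3 ?_ D' hN hdeg'
  have h : ((-1 : ℚ) ^ (3 / 2) * 3) = -3 := by norm_num
  rwa [h]

end TQMP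

end Summit.BirchSwinnertonDyer.BirchSwinnertonDyer.Theorems.TameQuarticManinParity.TwistPairAtThree

end
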